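import Summits.BirchSwinnertonDyer.BirchSwinnertonDyer.Theses.GenusKolyvaginAtTwo
import Literature.NumberTheory.EllipticCurves.CasselsTateParity
import Literature.GroupTheory.FiniteAbelian.SymplecticModules
import HarnessLib

/-!
# Route `GenusKolyvaginAtTwo`, LINE 13, crux U `ShaCardDvdPowAtTwoR` (stmt-BirchSwinnertonDyer-28029):
# ONE BIT IS FREE — `#Ш(E/K)[2^∞] ∣ 2^{2M₀+1}` already gives `#Ш(E/K)[2^∞] ∣ 2^{2M₀}`, granted the
# Cassels–Tate pairing on `Ш(E/K)` (square order of the finite `2`-primary part)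

Seat `bsd-line-gk2-p3` g14 (cell `bsd-f1-sign2`), `--supports stmt-BirchSwinnertonDyer-28029` (helper; closes nothing).
THEOREMS ONLY (no definition, no named fact introduced, no `sorry`); BSD is not proved by any of this.

Every road to U at `p = 2` on the cell bus loses a bit somewhere (the same-sign local pairing at an inert Kolyvagin prime
has image `2ℤ/2^M`; the `ℚ`-pair frame's bottom bits are entangled, `…ShaCardDvdPowAtTwoREntanglement`; Kolyvagin 1990
Thm. A has the error term `d` at `2`), so the natural target of the annihilation half is `#Ш(E/K)[2^∞] ∣ 2^{2M₀+c}`.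
This file records that an allowance of ONE bit costs nothing: the `2`-primary part of `Ш(E/K)`, once finite, has
SQUARE order by the Cassels–Tate pairing (alternating, kernel = divisible elements; the tree's named fact
`WeierstrassCurve.exists_casselsTate_pairing`, Cassels 1962 / Tate 1962, Silverman *AEC* X.4.14), and a square dividing
`2^{2M₀+1}` divides `2^{2M₀}`.

* §1 `dvd_pow_two_mul_of_isSquare_of_dvd_pow_succ` — arithmetic: `IsSquare n`, `n ∣ p^{2k+1}` ⟹ `n ∣ p^{2k}`.
* §2 `isSquare_natCard_primaryComponent_sha_of_casselsTate` — **`#Ш(E/K)[p^∞]` is a square when finite**, for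
  any elliptic `E` over any number field `K`, granted `exists_casselsTate_pairing (K := K)` (the restriction of the
  pairing to the finite `p`-primary part is nondegenerate: an element orthogonal to `Ш[p^∞]` is orthogonal to all of
  `Ш` by the coprime-order trick of `…CasselsTateParity`, hence divisible, hence `0` in a finite `p`-group; then
  `FiniteAbelian.isSquare_natCard`, Wall 1963 Lemma 7).
* §3 `natCard_sha_dvd_pow_of_dvd_pow_succ` — the pointwise reduction for `E_K = W ⊗ K` at `p = 2`, and
  `shaCardDvdPowAtTwoR_of_allowance_one` — **U follows from U-with-one-free-bit**: the statement of
  `ShaCardDvdPowAtTwoR` with conclusion `∣ 2^(2M₀+1)` implies `ShaCardDvdPowAtTwoR` itself, granted the Cassels–Tate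
  pairing over the (imaginary quadratic) fields `K` of the item.  Conditional on that named fact only.

References: [Cassels1962ArithmeticIV]; [SilvermanAEC2009] Thm. X.4.14; [MilneADT2006] I.6.13 (a), I.6.26;
[Wall1963QuadraticFormsFiniteGroups] Lemma 7; [McCallumLMS1991] Thm. 5.4; [KolyvaginEulerSystems1990] Thm. A.
-/

set_option autoImplicit false
set_option linter.dupNamespace false -- tree convention: `Summit.BirchSwinnertonDyer.BirchSwinnertonDyer.Theorems` (summit = sub-problem)

noncomputable section

open scoped Classical

namespace Summit.BirchSwinnertonDyer.BirchSwinnertonDyer.Theorems.GenusExact.VisiblePairAtTwo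

open WeierstrassCurve NumberField
open Literature.NumberTheory.EllipticCurves Literature.GroupTheory.FiniteAbelian

universe u

/-! ## §1 Arithmetic: a square dividing `p^{2k+1}` divides `p^{2k}` -/

/-- **A square dividing `p^{2k+1}` divides `p^{2k}`** (`n = p^j` with `j` even). [folklore] -/
theorem dvd_pow_two_mul_of_isSquare_of_dvd_pow_succ {p : ℕ} (hp : p.Prime) {n k : ℕ} (hn : IsSquare n)
    (h : n ∣ p ^ (2 * k + 1)) : n ∣ p ^ (2 * k) := by
  haveI : Fact p.Prime := ⟨hp⟩
  obtain ⟨j, hj, rfl⟩ := (Nat.dvd_prime_pow hp).mp h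
  obtain ⟨s, hs⟩ := hn
  have hs0 : s ≠ 0 := by
    rintro rfl
    rw [mul_zero] at hs
    exact pow_ne_zero j hp.ne_zero hs
  -- `j = 2 · v_p(s)` is even
  have hval : j = padicValNat p s + padicValNat p s := by
    have h1 : padicValNat p (p ^ j) = j := padicValNat.prime_pow j
    rw [hs, padicValNat.mul hs0 hs0] at h1
    exact h1.symm
  refine pow_dvd_pow p ?_
  omega

/-! ## §2 The finite `p`-primary part of `Ш(E/K)` has square order (Cassels–Tate) -/

section Sha

variable {K : Type u} [Field K] [NumberField K] (V : WeierstrassCurve K) [V.IsElliptic] (p : ℕ) [hp : Fact p.Prime]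

/-- Two coprime annihilators kill: `a • x = 0`, `b • x = 0`, `a ⊥ b` ⟹ `x = 0`. [folklore] -/
private theorem eq_zero_of_coprime_nsmul' {Q : Type*} [AddCommGroup Q] {x : Q} {a b : ℕ} (hab : a.Coprime b)
    (ha : a • x = 0) (hb : b • x = 0) : x = 0 := by
  rw [← addOrderOf_dvd_iff_nsmul_eq_zero] at ha hb
  exact AddMonoid.addOrderOf_eq_one_iff.mp (Nat.eq_one_of_dvd_coprimes hab ha hb)

/-- **`#Ш(E/K)[p^∞]` is a square when finite, granted the Cassels–Tate pairing.** For an elliptic `V` over a number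
field `K` with `Ш(V/K)[p^∞] = primaryComponent Ш p` finite: the Cassels–Tate pairing of `hCT` (alternating, kernel =
divisible elements) restricts to a nondegenerate alternating pairing on `Ш[p^∞]` — an element of `Ш[p^∞]` orthogonal
to `Ш[p^∞]` is orthogonal to all of the torsion group `Ш` (coprime orders), hence divisible in `Ш`, hence `p^k`-divisible
inside `Ш[p^∞]` for every `k`, hence `0` (finite `p`-group) — so `#Ш[p^∞]` is a square (`FiniteAbelian.isSquare_natCard`).
[cite: SilvermanAEC2009, Thm. X.4.14] [cite: Wall1963QuadraticFormsFiniteGroups, Lemma 7] [cite: Cassels1962ArithmeticIV] -/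
theorem isSquare_natCard_primaryComponent_sha_of_casselsTate (hCT : exists_casselsTate_pairing (K := K))
    [Finite (AddCommGroup.primaryComponent V.sha p)] :
    IsSquare (Nat.card (AddCommGroup.primaryComponent V.sha p)) := by
  obtain ⟨B, halt, hkerB⟩ := hCT V
  set A : AddSubgroup V.sha := AddCommGroup.primaryComponent V.sha p with hAdef
  have hA : ∀ a : A, ∃ n : ℕ, p ^ n • a = 0 := fun a ↦ by
    obtain ⟨n, hn⟩ := (AddCommGroup.mem_primaryComponent).mp a.2
    exact ⟨n, Subtype.ext hn⟩
  -- the restricted pairing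
  let BA : A →+ A →+ AddCircle (1 : ℚ) := (AddMonoidHom.compHom' A.subtype).comp (B.comp A.subtype)
  have hBA : ∀ a b : A, BA a b = B a b := fun _ _ ↦ rfl
  have hBAalt : ∀ a : A, BA a a = 0 := fun a ↦ by rw [hBA, halt]
  -- nondegeneracy on the finite `p`-primary part
  have hnd : ∀ a : A, (∀ b : A, BA a b = 0) → a = 0 := by
    intro a ha
    obtain ⟨e, he⟩ := hA a
    -- `a` is orthogonal to all of `Ш`
    have hall : ∀ z : V.sha, B a z = 0 := by
      intro z
      have hz := V.isTorsion_sha z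
      set n := addOrderOf z with hn
      have hn0 : n ≠ 0 := (hz.addOrderOf_pos).ne'
      obtain ⟨v, m, hm, hnm⟩ := Nat.exists_eq_pow_mul_and_not_dvd hn0 p hp.out.ne_one
      have hmz : m • z ∈ A := by
        rw [hAdef, AddCommGroup.mem_primaryComponent]
        refine ⟨v, ?_⟩
        rw [smul_smul, ← hnm, hn, addOrderOf_nsmul_eq_zero]
      have h1 : m • B a z = 0 := by
        rw [← map_nsmul]
        have h := ha ⟨m • z, hmz⟩
        rwa [hBA] at h
      have h2 : p ^ e • B a z = 0 := by
        rw [← AddMonoidHom.nsmul_apply, ← map_nsmul]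
        have : (p ^ e • a : A) = 0 := he
        rw [← AddSubgroupClass.coe_nsmul, this, ZeroMemClass.coe_zero, map_zero, AddMonoidHom.zero_apply]
      exact eq_zero_of_coprime_nsmul'
        (Nat.Coprime.pow_left e ((Nat.Prime.coprime_iff_not_dvd hp.out).mpr hm)) h2 h1
    -- hence divisible in `Ш`: `a = p^k • y` with `y ∈ A`, for `k = #A`
    have hdivz : ((a : A) : V.sha) ∈ AddSubgroup.divisibleElements V.sha := (hkerB _).mp hall
    set k : ℕ := Nat.card A with hk
    obtain ⟨y, hy⟩ := (AddSubgroup.mem_divisibleElements_iff _ _).mp hdivz (p ^ k) (pow_pos hp.out.pos k)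
    have hyA : y ∈ A := by
      rw [hAdef, AddCommGroup.mem_primaryComponent]
      refine ⟨k + e, ?_⟩
      rw [pow_add, mul_comm, ← smul_smul, hy, ← AddSubgroupClass.coe_nsmul]
      have : (p ^ e • a : A) = 0 := he
      rw [this, ZeroMemClass.coe_zero]
    -- `p^k` kills `y ∈ A`: the order of `y` is a `p`-power `p^j ∣ #A = k`, so `j < k`
    have hy0 : p ^ k • (⟨y, hyA⟩ : A) = 0 := by
      obtain ⟨n, hn⟩ := hA ⟨y, hyA⟩
      have hdvd : addOrderOf (⟨y, hyA⟩ : A) ∣ p ^ n := addOrderOf_dvd_iff_nsmul_eq_zero.mpr hn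
      obtain ⟨j, -, hj⟩ := (Nat.dvd_prime_pow hp.out).mp hdvd
      have hjk : p ^ j ∣ k := hj ▸ addOrderOf_dvd_natCard (⟨y, hyA⟩ : A)
      have hkpos : 0 < k := Nat.card_pos
      have hjlt : j < k := lt_of_lt_of_le (Nat.lt_pow_self hp.out.one_lt) (Nat.le_of_dvd hkpos hjk)
      apply addOrderOf_dvd_iff_nsmul_eq_zero.mp
      rw [hj]
      exact pow_dvd_pow p hjlt.le
    apply Subtype.ext
    rw [ZeroMemClass.coe_zero, ← hy]
    have := congrArg (fun t : A ↦ (t : V.sha)) hy0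
    simpa only [AddSubgroupClass.coe_nsmul, ZeroMemClass.coe_zero] using this
  exact isSquare_natCard BA hBAalt hnd

end Sha

/-! ## §3 U follows from U with one free bit -/

/-- **Pointwise reduction at `p = 2`**: if `#Ш(E_K)[2^∞] ∣ 2^{2M₀+1}` then `#Ш(E_K)[2^∞] ∣ 2^{2M₀}`, granted the
Cassels–Tate pairing over `K` (`#Ш[2^∞] ≠ 0` forces finiteness, then §2 and §1).
[cite: SilvermanAEC2009, Thm. X.4.14] [cite: McCallumLMS1991, Thm. 5.4] -/
theorem natCard_sha_dvd_pow_of_dvd_pow_succ {K : Type} [Field K] [NumberField K]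
    (hCT : exists_casselsTate_pairing (K := K)) (V : WeierstrassCurve K) [V.IsElliptic] {M₀ : ℕ}
    (h : Nat.card (AddCommGroup.primaryComponent V.sha 2) ∣ 2 ^ (2 * M₀ + 1)) :
    Nat.card (AddCommGroup.primaryComponent V.sha 2) ∣ 2 ^ (2 * M₀) := by
  haveI : Fact (Nat.Prime 2) := ⟨Nat.prime_two⟩
  have hne : Nat.card (AddCommGroup.primaryComponent V.sha 2) ≠ 0 := fun h0 ↦ by
    rw [h0] at h
    exact (pow_ne_zero _ two_ne_zero) (zero_dvd_iff.mp h)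
  haveI : Finite (AddCommGroup.primaryComponent V.sha 2) := Nat.finite_of_card_ne_zero hne
  exact dvd_pow_two_mul_of_isSquare_of_dvd_pow_succ Nat.prime_two
    (isSquare_natCard_primaryComponent_sha_of_casselsTate V 2 hCT) h

open Literature.NumberTheory.GaloisRepresentations in
/-- **U with ONE FREE BIT implies U** (`ShaCardDvdPowAtTwoR`, stmt-BirchSwinnertonDyer-28029), granted the
Cassels–Tate pairing over the number fields `K` of the item: the hypothesis `h₁` is the statement of
`ShaCardDvdPowAtTwoR` VERBATIM except that its conclusion reads `∣ 2 ^ (2 * M₀ + 1)`.  So an annihilation argument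
at `2` that loses a single bit in total still closes U; two or more bits do not come back this way.
[cite: SilvermanAEC2009, Thm. X.4.14] [cite: McCallumLMS1991, Thm. 5.4] [cite: KolyvaginEulerSystems1990, Thm. A] -/
theorem shaCardDvdPowAtTwoR_of_allowance_one
    (hCT : ∀ (K : Type) [Field K] [NumberField K], exists_casselsTate_pairing (K := K))
    (h₁ : Theses.GenusKolyvaginAtTwo.KolyvaginRelationAtTwo → Theses.GenusKolyvaginAtTwo.EquivariantChebotarevAtTwoR →
      (∀ (W : WeierstrassCurve ℚ) [W.IsElliptic], W.Δ < 0 → ∀ (c₀ : Field.absoluteGaloisGroup ℚ),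
        IsComplexConjugation (Rat.castHom ℝ) c₀ → ∀ (M : ℕ), ∃ P : W.geomTorsion ((2 ^ M : ℕ) : ℤ),
          ∀ Q : W.geomTorsion ((2 ^ M : ℕ) : ℤ), ∃ a b : ℤ, Q = a • P + b • (c₀ • P)) →
      ∀ (W : WeierstrassCurve ℚ) [W.IsElliptic] [W.IsGloballyMinimal] [NeZero (W.conductorNorm ℤ)], ¬ W.HasCM →
        W.Δ < 0 → ∀ (K : Type) [Field K] [NumberField K], IsImaginaryQuadratic K → Odd (NumberField.discr K) →
        NumberField.discr K ≠ -3 → SatisfiesHeegnerHypothesis (W.conductorNorm ℤ) K →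
        ¬ IsSquare ((NumberField.discr K : ℚ) * -|W.Δ|) → ¬ IsSquare ((NumberField.discr K : ℚ) * (-(2 * |W.Δ|))) →
        (∀ n : ℕ, 0 < n → W.HasSurjectiveModNGaloisRep ((2 : ℤ) ^ n)) →
        ∀ (Dt : ModularForms.ModularParametrizationData W (W.conductorNorm ℤ)) (β : ℤ) (ι : K →+* ℂ)
          (d₁ : KolyvaginHeegnerData Dt β ι 1), ¬ IsOfFinAddOrder d₁.derivedPoint → ∀ (M₀ : ℕ),
          (∃ Q : (W.baseChange (ringClassField K ι 1)).toAffine.Point, ((2 ^ M₀ : ℕ) : ℤ) • Q = d₁.derivedPoint) →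
          (¬ ∃ Q : (W.baseChange (ringClassField K ι 1)).toAffine.Point,
            ((2 ^ (M₀ + 1) : ℕ) : ℤ) • Q = d₁.derivedPoint) →
          ∀ (n : ℕ) (d : KolyvaginHeegnerData Dt β ι n), Squarefree n →
            (∀ ℓ ∈ n.primeFactors, Zhang2014.IsKolyvaginPrime (W.conductorNorm ℤ) W K 2 ℓ) →
            (¬ ∃ Q : (W.baseChange (ringClassField K ι n)).toAffine.Point, (2 : ℤ) • Q = d.derivedPoint) →
            Nat.card (AddCommGroup.primaryComponent (W.baseChange K).sha 2) ∣ 2 ^ (2 * M₀ + 1)) :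
    Theses.GenusKolyvaginAtTwo.ShaCardDvdPowAtTwoR := by
  intro hQ2 hQ5 hQ1 W _ _ _ hcm hΔ K _ _ hK hodd h3 hH hsq hsq2 hsurj Dt β ι d₁ hy M₀ hdiv hndiv n d hn hKol hprim
  exact natCard_sha_dvd_pow_of_dvd_pow_succ (hCT K) (W.baseChange K)
    (h₁ hQ2 hQ5 hQ1 W hcm hΔ K hK hodd h3 hH hsq hsq2 hsurj Dt β ι d₁ hy M₀ hdiv hndiv n d hn hKol hprim)

end Summit.BirchSwinnertonDyer.BirchSwinnertonDyer.Theorems.GenusExact.VisiblePairAtTwo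

end
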